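import Mathlib
import HarnessLib
import Summits.NavierStokesRegularity.NavierStokesRegularity.Theorems.UnthreadedRigidityDoorUnthreadedRigidityTwoShellTopComponent
import Summits.NavierStokesRegularity.NavierStokesRegularity.Theorems.UnthreadedRigidityDoorUnthreadedRigidityVirialHornBracketTwo

/-!
# Route `UnthreadedRigidityDoor`, item `UnthreadedRigidity` (W2, stmt-NavierStokesRegularity-27585) — LINE g12-1 «CO-ZONAL» / g12-2 «PERSISTENCE»:
# THE TOP-COMPONENT LEMMAS ON THE SPHERE — `Y²|_{S²}` is not a polynomial of degree `< 2l`, `|∇Y|²|_{S²}` not one of degree `< 2l − 2`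

Prover file (engine-1 g74; `--supports stmt-NavierStokesRegularity-27585 --as helper`; route-independent imports).

The two typed signatures of HOME engine/engine-1/HANDOFF-engine1-g73.md §1b («TOP COMPONENT LEMMA», `top_component_sq`, `top_component_gradSq`)
in the W2 door's analytic currency (`VirialHorn.IsSolidHarmonic`), derived from the chart-currency lemmas (T1) `chartT_map_ne_zero` and ★ (T2)
`chartT_map_dotP_ne_zero` of `…TwoShellTopComponent` through one HOMOGENISATION LEMMA:

* ★ `chartT_map_eq_zero_of_lowDegree_on_sphere` — if a homogeneous `G` of EVEN degree `2n` agrees on the unit sphere with a polynomial `P` of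
  total degree `< 2n`, then `chartT G = 0` (`G ∈ ρ·ℝ[x]`): by parity only the even homogeneous components `P_{2m}` (`m < n`) matter, the
  homogeneous polynomial `G − Σ_m P_{2m} ρ^{n−m}` vanishes on `S²`, hence on `ℝ³`, hence is `0` (`Zonal.eq_zero_of_evalE_eq_zero`), and every
  `ρ^{n−m}` dies on the null cone;
* `IsSolidHarmonic.sq_ne_lowDegree_on_sphere` — for a nonzero solid harmonic `Y` of degree `l`, there is NO polynomial `P` of total degree
  `< 2l` with `Y(u)² = P(u)` on `S²`;
* ★ `IsSolidHarmonic.gradSq_ne_lowDegree_on_sphere` — … and NO `P` of total degree `< 2l − 2` with `|∇Y(u)|² = P(u)` on `S²` (`l ≥ 1`).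

HONEST LABEL: algebra of solid harmonics (support of a rung line); nothing here bears on `UnthreadedRigidity` (27585), the door Target, W2 or
Navier–Stokes regularity; no summit statement is proved.  MODEL/rung work; 0 kit.  [folklore]
-/

noncomputable section

-- the summit and its single sub-problem share the name (CONVENTIONS §1), as in every Theorems file
set_option linter.dupNamespace false

namespace Summit.NavierStokesRegularity.NavierStokesRegularity.Theorems.UnthreadedRigidity.MixedPair

open MvPolynomial Finset
open scoped Polynomial RealInnerProductSpace
open Literature.Geometry.DiscreteGeometry (norm_sq_fin3)
open Summit.NavierStokesRegularity.NavierStokesRegularity.Theorems.UnthreadedRigidity.ProfileHorn (E3)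
open Summit.NavierStokesRegularity.NavierStokesRegularity.Theorems.UnthreadedRigidity.VirialHorn (IsSolidHarmonic
  IsSolidHarmonic.exists_evalE)
open Summit.NavierStokesRegularity.NavierStokesRegularity.Theorems.PoloidalLiouville.HorizonTower.Zonal

/-! ## §1 Homogenisation of a low-degree sphere identity -/

/-- pairing consecutive terms: `Σ_{i<2n} f i = Σ_{m<n} (f(2m) + f(2m+1))`. -/
theorem sum_range_two_mul {M : Type*} [AddCommMonoid M] (f : ℕ → M) (n : ℕ) :
    ∑ i ∈ range (2 * n), f i = ∑ m ∈ range n, (f (2 * m) + f (2 * m + 1)) := by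
  induction n with
  | zero => simp
  | succ n ih => rw [show 2 * (n + 1) = 2 * n + 1 + 1 by ring, sum_range_succ, sum_range_succ, ih, sum_range_succ, add_assoc]

/-- homogeneous polynomials scale: `R(c•u) = c^n R(u)`. -/
theorem evalE_smul_of_isHomogeneous {R : MvPolynomial (Fin 3) ℝ} {n : ℕ} (hR : R.IsHomogeneous n) (c : ℝ) (u : E3) :
    evalE R (c • u) = c ^ n * evalE R u := by
  have harg : (fun i => (c • u) i) = fun i => c * u i := by funext i; simp
  unfold evalE
  rw [harg, eval_smul_of_isHomogeneous hR]

/-- all homogeneous components up to any bound beyond the total degree sum to the polynomial. -/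
theorem sum_homogeneousComponent_range_of_lt (P : MvPolynomial (Fin 3) ℝ) {N : ℕ} (hN : P.totalDegree < N) :
    ∑ i ∈ range N, homogeneousComponent i P = P := by
  obtain ⟨k, rfl⟩ := Nat.exists_eq_add_of_lt hN
  rw [show P.totalDegree + k + 1 = (P.totalDegree + 1) + k by ring, sum_range_add, sum_homogeneousComponent]
  rw [sum_eq_zero (fun i _ => homogeneousComponent_eq_zero _ _ (by omega)), add_zero]

/-- ★ **HOMOGENISATION**: a homogeneous `G` of even degree `2n` that agrees on the unit sphere with a polynomial of total degree `< 2n` dies on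
the null cone: `chartT G = 0` (i.e. `ρ ∣ G`). [folklore] -/
theorem chartT_map_eq_zero_of_lowDegree_on_sphere {G P : MvPolynomial (Fin 3) ℝ} {n : ℕ} (hG : G.IsHomogeneous (2 * n))
    (hdeg : P.totalDegree < 2 * n) (h : ∀ u : E3, ‖u‖ = 1 → evalE G u = evalE P u) :
    chartT (map (algebraMap ℝ ℂ) G) = 0 := by
  -- parity: on `S²`, `G = Σ_{m<n} P_{2m}`
  have hsum : ∀ u : E3, evalE P u = ∑ i ∈ range (2 * n), evalE (homogeneousComponent i P) u := fun u => by
    conv_lhs => rw [← sum_homogeneousComponent_range_of_lt P hdeg]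
    unfold evalE; rw [map_sum]
  have heven : ∀ u : E3, ‖u‖ = 1 → evalE G u = ∑ m ∈ range n, evalE (homogeneousComponent (2 * m) P) u := by
    intro u hu
    have h1 := h u hu
    have h2 := h (-u) (by rwa [norm_neg])
    rw [show -u = (-1 : ℝ) • u by simp, evalE_smul_of_isHomogeneous hG, pow_mul, neg_one_sq, one_pow, one_mul, hsum,
      sum_range_two_mul] at h2
    rw [hsum, sum_range_two_mul] at h1
    have hterm : ∀ m : ℕ, evalE (homogeneousComponent (2 * m) P) ((-1 : ℝ) • u) + evalE (homogeneousComponent (2 * m + 1) P) ((-1 : ℝ) • u)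
        = evalE (homogeneousComponent (2 * m) P) u - evalE (homogeneousComponent (2 * m + 1) P) u := fun m => by
      rw [evalE_smul_of_isHomogeneous (homogeneousComponent_isHomogeneous _ _),
        evalE_smul_of_isHomogeneous (homogeneousComponent_isHomogeneous _ _), pow_mul, neg_one_sq, one_pow, one_mul, pow_succ, pow_mul,
        neg_one_sq, one_pow, one_mul]
      ring
    simp only [hterm] at h2
    have h3 := congrArg₂ (· + ·) h1 h2
    simp only [← sum_add_distrib] at h3
    have h4 : ∑ m ∈ range n, (evalE (homogeneousComponent (2 * m) P) u + evalE (homogeneousComponent (2 * m + 1) P) u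
        + (evalE (homogeneousComponent (2 * m) P) u - evalE (homogeneousComponent (2 * m + 1) P) u))
        = 2 * ∑ m ∈ range n, evalE (homogeneousComponent (2 * m) P) u := by
      rw [mul_sum]; exact sum_congr rfl fun m _ => by ring
    rw [h4] at h3
    linarith
  -- the homogenised polynomial vanishes everywhere
  set F : MvPolynomial (Fin 3) ℝ := G - ∑ m ∈ range n, homogeneousComponent (2 * m) P * normSq ^ (n - m) with hF
  have hρ : ∀ y : E3, evalE normSq y = ‖y‖ ^ 2 := fun y => by rw [norm_sq_fin3]; simp [normSq, evalE]
  have hFev : ∀ y : E3, evalE F y = evalE G y - ∑ m ∈ range n, evalE (homogeneousComponent (2 * m) P) y * (‖y‖ ^ 2) ^ (n - m) := by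
    intro y
    rw [hF, evalE_sub]
    congr 1
    unfold evalE
    rw [map_sum]
    refine sum_congr rfl fun m _ => ?_
    rw [map_mul, map_pow]
    congr 2
    exact hρ y
  have hzero : ∀ y : E3, evalE F y = 0 := by
    intro y
    rw [hFev]
    by_cases hy : y = 0
    · rcases Nat.eq_zero_or_pos n with hn | hn
      · subst hn; exfalso; omega
      · rw [hy, norm_zero, show evalE G 0 = 0 from by
          have := evalE_smul_of_isHomogeneous hG 0 (0 : E3)
          rw [zero_smul, zero_pow (by omega), zero_mul] at this; exact this]
        rw [sum_eq_zero (fun m hm => ?_), sub_zero]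
        rw [zero_pow two_ne_zero, zero_pow (by have := mem_range.mp hm; omega), mul_zero]
    · obtain ⟨r, hr, u, hu, hyu⟩ : ∃ r : ℝ, 0 < r ∧ ∃ u : E3, ‖u‖ = 1 ∧ y = r • u := by
        have hr : 0 < ‖y‖ := norm_pos_iff.2 hy
        refine ⟨‖y‖, hr, ‖y‖⁻¹ • y, by rw [norm_smul, norm_inv, norm_norm, inv_mul_cancel₀ hr.ne'], ?_⟩
        rw [smul_smul, mul_inv_cancel₀ hr.ne', one_smul]
      rw [hyu, evalE_smul_of_isHomogeneous hG, heven u hu, mul_sum, ← sum_sub_distrib]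
      refine sum_eq_zero fun m hm => ?_
      have hm' : m < n := mem_range.mp hm
      rw [evalE_smul_of_isHomogeneous (homogeneousComponent_isHomogeneous _ _), norm_smul, Real.norm_of_nonneg hr.le, hu, mul_one,
        show (r ^ 2) ^ (n - m) = r ^ (2 * n - 2 * m) by rw [← pow_mul]; congr 1; omega,
        show r ^ (2 * n) = r ^ (2 * m) * r ^ (2 * n - 2 * m) by rw [← pow_add]; congr 1; omega]
      ring
  have hFz : F = 0 := eq_zero_of_evalE_eq_zero hzero
  -- chart
  have hc := congrArg (fun Q : MvPolynomial (Fin 3) ℝ => chartT (map (algebraMap ℝ ℂ) Q)) hFz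
  simp only [hF, map_sub, map_zero, chartT_sub, chartT_zero, map_sum, chartT_sum, map_mul, map_pow, map_normSq, chartT_mul, chartT_pow,
    chartT_normSq] at hc
  rw [sum_eq_zero (fun m hm => by rw [zero_pow (by have := mem_range.mp hm; omega), mul_zero]), sub_zero] at hc
  exact hc

/-! ## §2 The two top-component lemmas on the sphere -/

/-- `Y²|_{S²}` IS NOT A POLYNOMIAL OF DEGREE `< 2l` for a nonzero solid harmonic `Y` of degree `l` (the degree-`2l` spherical-harmonic
component of `Y²` is nonzero). [folklore] -/
theorem IsSolidHarmonic.sq_ne_lowDegree_on_sphere {l : ℕ} {Y : E3 → ℝ} (hY : IsSolidHarmonic l Y) (hne : ∃ y, Y y ≠ 0) :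
    ¬ ∃ P : MvPolynomial (Fin 3) ℝ, P.totalDegree < 2 * l ∧ ∀ u : E3, ‖u‖ = 1 → Y u ^ 2 = evalE P u := by
  rintro ⟨P, hdeg, hP⟩
  obtain ⟨Q, hQh, hQl, hYQ⟩ := hY.exists_evalE
  have hQ0 : Q ≠ 0 := by
    rintro rfl
    obtain ⟨y, hy⟩ := hne
    exact hy (by rw [hYQ]; simp [evalE])
  have hG : (Q * Q).IsHomogeneous (2 * l) := by have h := hQh.mul hQh; rwa [← two_mul] at h
  have h := chartT_map_eq_zero_of_lowDegree_on_sphere hG hdeg (fun u hu => by rw [evalE_mul, ← hP u hu, hYQ, sq])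
  exact chartT_map_sq_ne_zero hQh hQl hQ0 h

/-- `∇Q·∇Q` is homogeneous of degree `2(l−1)` for `Q` homogeneous of degree `l`. -/
theorem isHomogeneous_dotP_self {Q : MvPolynomial (Fin 3) ℝ} {l : ℕ} (hQ : Q.IsHomogeneous l) : (dotP Q Q).IsHomogeneous (2 * (l - 1)) := by
  have h : ∀ i : Fin 3, (pderiv i Q * pderiv i Q).IsHomogeneous (2 * (l - 1)) := fun i => by
    have h1 := (hQ.pderiv (i := i)).mul (hQ.pderiv (i := i)); rwa [← two_mul] at h1
  exact ((h 0).add (h 1)).add (h 2)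

/-- ★ `|∇Y|²|_{S²}` IS NOT A POLYNOMIAL OF DEGREE `< 2l − 2` for a nonzero solid harmonic `Y` of degree `l ≥ 1` (the degree-`(2l−2)`
spherical-harmonic component of `|∇Y|²` is nonzero — (T2)). [folklore] -/
theorem IsSolidHarmonic.gradSq_ne_lowDegree_on_sphere {l : ℕ} {Y : E3 → ℝ} (hl : 1 ≤ l) (hY : IsSolidHarmonic l Y) (hne : ∃ y, Y y ≠ 0) :
    ¬ ∃ P : MvPolynomial (Fin 3) ℝ, P.totalDegree < 2 * l - 2 ∧ ∀ u : E3, ‖u‖ = 1 → ‖gradient Y u‖ ^ 2 = evalE P u := by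
  rintro ⟨P, hdeg, hP⟩
  obtain ⟨Q, hQh, hQl, hYQ⟩ := hY.exists_evalE
  have hQ0 : Q ≠ 0 := by
    rintro rfl
    obtain ⟨y, hy⟩ := hne
    exact hy (by rw [hYQ]; simp [evalE])
  have hG : (dotP Q Q).IsHomogeneous (2 * (l - 1)) := isHomogeneous_dotP_self hQh
  have hdeg' : P.totalDegree < 2 * (l - 1) := by omega
  have h := chartT_map_eq_zero_of_lowDegree_on_sphere hG hdeg' (fun u hu => by
    rw [← hP u hu, hYQ]; exact (congrFun (norm_gradient_sq_evalE Q) u).symm)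
  exact chartT_map_dotP_ne_zero' hl hQh hQl hQ0 h

end Summit.NavierStokesRegularity.NavierStokesRegularity.Theorems.UnthreadedRigidity.MixedPair

end
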